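import Summits.QuantumFields.YangMills.Theorems.UnitScaleTiltHalvingP1FlatPillarRoomOfSuppliers
import HarnessLib

/-!
# Route `UnitScaleTilt`, crux K1 child «MinimiserStabilityRegPr» (stmt-QuantumFields-19200), registered stub `stub_halvingStep` (v10 `BirthV10`) —
# **LEAD-H g6 SMALL-`Cr` EXIT (prefix «ρ4» = ρ3 + `4 < Cr`): THE CONSTANTS WRAPPER — `hP1roomρ4_of_suppliers (hSupUρ4) : hP1roomρ4`**, the byte-twin of
# ✓`HalvingP1FlatPillarRoomOfSuppliersRho3.hP1roomρ3_of_suppliers` (LEAD-H g5) with ONE change on both sides: the antecedent `4 < Cr →` inserted right after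
# `0 < Cr →` in the member prefix (the door ✓`HalvingStubOfHP1RoomRho3` instantiates `Cr := 4C′B₀B₃ ≥ 8`, so the extra antecedent costs the door nothing —
# see ✓`HalvingStubOfHP1RoomRho4`; it is what the ε₁-route of the top-level (1.42) row needs: `Cr·ε₁ ≤ ε₀ ∧ 4 < Cr ⇒ ε₁ ≤ ε₀∕4`, LEAD-H LOCATE-H42-TOP §2 (ii))

Cell `ym3-torus` (HUMAN RULING D-0037, YM ladder rung R3 — YM₃ on T³ is a RUNG, NOT the Clay problem), width seat `ym-ust-19200-w5` gen 6 (LEAD-H g6).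
`--supports stmt-QuantumFields-19200 --as helper`; count-neutral; def-free, 0 sorry, standard axioms.  `hSupUρ4` is a HYPOTHESIS; nothing here claims the stub, the crux,
the rung or the mass gap.  Proof = ✓p653124's VERBATIM with the one binder `hCr4` threaded next to `hCr` (received, handed to the per-site body; unused otherwise).
* ★★★ `hP1roomρ4_of_suppliers (hSupUρ4) : <hP1roomρ4>` — so that `stub_halvingStep_of_hP1roomρ4 (hP1roomρ4_of_suppliers hSupUρ4)` is the registered H text from
  the ONE displayed text `hSupUρ4`.
HONEST SCOPE.  Quantifier∕constants bookkeeping over landed rows; NOT a claim about [Balaban1985RegularSpaces] Thm 2, the stub, the crux, the rung or the mass gap.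

References: T. Bałaban, CMP **99** (1985) 75–102 [Balaban1985RegularSpaces] Thm 2 p.83, (1.33)–(1.38) p.82, (1.65)–(1.66) p.87; CMP **102** (1985) 277–309
[Balaban1985Variational] Prop 2 p.281, (144) p.300, (150)–(156) pp.301–302, (160) p.303.
-/

set_option autoImplicit false

noncomputable section

open scoped BigOperators Matrix.Norms.L2Operator

namespace Summit.QuantumFields.YangMills.Theorems.HalvingP1FlatPillarRoomOfSuppliersRho4

open Literature.MathematicalPhysics.QuantumFieldTheory.Balaban1983to89
open Literature.MathematicalPhysics.QuantumFieldTheory.Balaban1983to89.T3ContinuumYM3Torus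
open Literature.MathematicalPhysics.QuantumFieldTheory.Balaban1983to89.T3PrintedRegularMinimiser
open T4Continuum BlockAveraging ExpMeanLog T3RegularMinimiser
open Complex (I)
open MatrixLog (mlog)
open B5Eq118OneStroke (iterBlockOf)
open B6SectAOperatorsV1 (SiteIdx)
open B7Prop1Explicit renaming Site → LSite
open B7Prop1Explicit (e)
open B7Prop1Local (InBox)
open B8Eq131Cubes (cube flm gs sqLo sqHi)
open B8Eq138LandauZd (covDivB covLap QT)
open B8CubeMemberZd (cubeLamS)
open B10Eq27TorusAxialLog (transl rel unitsField toUField suIncl gaugeActT axialT)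
open B15Eq112TorusCover (lift)
open Node00 (coverAt)
open LatticeFieldCalculus (laplace diverg siteAvgIter)
open FlatCubeOpsText (IsLevWeight)
open FlatCubeSequenceAligned (cubeSeqMT3 cubeSetM)
open Summit.QuantumFields.YangMills.Theorems.Prop8ChartDoubleBar (dbarIterU vframeU)
open HalvingP1FlatPillar (DP1Clause)
open HalvingP1FlatPillarPrime (P1FlatPillarAt')
open HalvingP1FlatCoreExtractionMult (p1FlatPillar'_room_of_mlogChartDataMult)
open HalvingP1FlatCoreChartDataDoor (mlogChartDataMult_of_suppliers_cubeLamS)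
open P1FlatCoreCubeInclusion (corner_of_offset room_of_level_k)
open P1FlatCoreDP1Target (sitesPerDir_top_eq)
open HalvingP1FlatCoreFamilyDoor (p1FlatPillar'_room_of_suppliers)

open HalvingP1FlatPillarRoomOfSuppliers (cubeData_of_prefix window_mono_B₁ ha7_of_window)

/-! ## ★★★ `hP1roomρ4` from the uniform supplier binder `hSupUρ4` (ρ3 + `4 < Cr`) -/

open Classical in
/-- ★★★ **SMALL-`Cr` EXIT «ρ4» — THE H DOOR's `hP1roomρ4` FROM THE UNIFORM SUPPLIER BINDER `hSupUρ4`.**  Both texts are ✓`hP1roomρ3_of_suppliers`' with the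
antecedent `4 < Cr →` inserted right after `0 < Cr →`; body, constants (`Rₚ ↦ max Rₚ (2L)`, `B₁ ↦ max B₁ 6`, `Nr := M′ + 1 + 2(M + L + S)`, `ρ′ := ρ + M + L + S`) and
proof VERBATIM (✓p653124), the binder `hCr4` handed to the per-site body.
[cite: Balaban1985RegularSpaces, Thm 2 p.83, (1.33)-(1.38) p.82, (1.65)-(1.66) p.87; Balaban1985Variational, Prop 2 p.281, (144) p.300, (150)-(156) pp.301-302, (160) p.303] -/
theorem hP1roomρ4_of_suppliers
    (hSupUρ4 : ∀ L : ℕ, Odd L → 1 < L → ∃ (Mₚ Rₚ : ℕ), ∀ (R M aₑ S : ℕ) (hM : 1 ≤ M), M = L ^ aₑ → Mₚ ≤ M → Rₚ ≤ R → R * M ≤ S →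
      ∃ B₁ : ℝ, 0 ≤ B₁ ∧ ∃ M' : ℕ, 1 ≤ M' ∧ ∃ Cρ : ℝ, 0 < Cρ ∧ ∃ qρ : ℕ,
      ∀ (ρ : ℕ) (a Cr : ℝ), 0 < Cr → 4 < Cr → 12 * ((ρ : ℝ) + (M : ℝ)) * a ≤ Cr →
        16 * 3800 * ((5 * L : ℕ) : ℝ) ^ 2 * (L : ℝ) * ((B₁ * ((ρ : ℝ) + 1) ^ qρ + 1) * a) ≤ 1 → Cρ * ((ρ : ℝ) + 1) ^ qρ * a ≤ 1 →
        ∀ F : T3Family, F.L = L → ∀ (n K : ℕ) (hnK : n < K), 2 * ρ + (M' + 1 + 2 * (M + L + S)) ≤ F.L ^ (F.m + n) →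
          ∀ (ε₀ ε₁ : ℝ), 0 < ε₁ → 0 < ε₀ → ε₀ ≤ a → Cr * ε₁ ≤ ε₀ →
          ∀ V : GaugeField (F.P n) 0 (Matrix.specialUnitaryGroup (Fin 2) ℂ), PlaqSmall ε₁ V →
            ∀ U ∈ regFibrePr F n K hnK.le ε₀ V, ∀ x₀ : Site (F.P K) 0,
              ∃ (t : ℤ) (_ : 0 ≤ t) (_ : t ≤ (M' : ℤ) - 1)
                (w : LSite (F.P K).d → Matrix.specialUnitaryGroup (Fin 2) ℂ) (X : LSite (F.P K).d → Fin (F.P K).d → Matrix (Fin 2) (Fin 2) ℂ)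
                (μ : ℕ → LSite (F.P K).d → Matrix (Fin 2) (Fin 2) ℂ)
                (g h' : GaugeTransf (F.P K) 0 (Matrix (Fin 2) (Fin 2) ℂ)ˣ) (κ' : (i : ℕ) → GaugeTransf (F.P K) i (Matrix (Fin 2) (Fin 2) ℂ)ˣ)
                (ν : (i : ℕ) → Site (F.P K) i → (Matrix (Fin 2) (Fin 2) ℂ)ˣ) (gs' : (i : ℕ) → GaugeTransf (F.P K) i (Matrix (Fin 2) (Fin 2) ℂ)ˣ),
                -- [N05 ∕ J3] chart rows and flat Landau window at the corner `a := Bᵏx₀ − t`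
                (∀ z ∈ cube (F.P K).L (fun μ => ((iterBlockOf (K - n) x₀ μ).val : ℤ) - t) M' (ρ + M + L + S) (K - n) 0, ∀ ν : Fin (F.P K).d,
                  transl (0 : Site (F.P K) 0) z ∈ cubeSetM x₀ (K - n) ρ S M 0 → (transl (0 : Site (F.P K) 0) z).shift ν ∈ cubeSetM x₀ (K - n) ρ S M 0 →
                  ‖(((Unitary.toUnits (suIncl (w z)))⁻¹ * unitsField (toUField U) ⟨transl 0 z, ν⟩ * Unitary.toUnits (suIncl (w (z + e ν))) :
                      (Matrix (Fin 2) (Fin 2) ℂ)ˣ) : Matrix (Fin 2) (Fin 2) ℂ) - 1‖ ≤ 1 / 4) ∧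
                (∀ z ∈ cube (F.P K).L (fun μ => ((iterBlockOf (K - n) x₀ μ).val : ℤ) - t) M' (ρ + M + L + S) (K - n) 0, ∀ ν : Fin (F.P K).d,
                  transl (0 : Site (F.P K) 0) z ∈ cubeSetM x₀ (K - n) ρ S M 0 → (transl (0 : Site (F.P K) 0) z).shift ν ∈ cubeSetM x₀ (K - n) ρ S M 0 →
                  I • ((((F.L : ℝ)⁻¹) ^ (K - n)) • X z ν) = mlog (((Unitary.toUnits (suIncl (w z)))⁻¹ * unitsField (toUField U) ⟨transl 0 z, ν⟩ *
                      Unitary.toUnits (suIncl (w (z + e ν))) : (Matrix (Fin 2) (Fin 2) ℂ)ˣ) : Matrix (Fin 2) (Fin 2) ℂ)) ∧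
                (∀ z ∈ cube (F.P K).L (fun μ => ((iterBlockOf (K - n) x₀ μ).val : ℤ) - t) M' (ρ + M + L + S) (K - n) 0,
                  covLap (((F.L : ℝ)⁻¹) ^ (K - n)) (1 : LSite (F.P K).d → Fin (F.P K).d → (Matrix (Fin 2) (Fin 2) ℂ)ˣ)
                      ((cube (F.P K).L (fun μ => ((iterBlockOf (K - n) x₀ μ).val : ℤ) - t) M' (ρ + M + L + S) (K - n) 0).indicator
                        (covDivB (((F.L : ℝ)⁻¹) ^ (K - n)) (1 : LSite (F.P K).d → Fin (F.P K).d → (Matrix (Fin 2) (Fin 2) ℂ)ˣ) X)) z =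
                    QT (F.P K).L (K - n) (cubeLamS (F.P K).L (fun μ => ((iterBlockOf (K - n) x₀ μ).val : ℤ) - t) M' (ρ + M + L + S) (K - n) (K - n))
                      (1 : LSite (F.P K).d → Fin (F.P K).d → (Matrix (Fin 2) (Fin 2) ℂ)ˣ) μ z) ∧
                -- [top step] frames, composite gauge, top identity
                κ' 0 = h' ∧
                (∀ (i : ℕ) (y : Site (F.P K) (i + 1)),
                  κ' (i + 1) y = (vframeU (gaugeActT (κ' i) (dbarIterU i (gaugeActT g (unitsField (toUField U))))) y)⁻¹ * κ' i (emb y) *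
                    vframeU (dbarIterU i (gaugeActT g (unitsField (toUField U)))) y) ∧
                (∀ s, ν 0 s = 1) ∧
                (∀ (i : ℕ) (y : Site (F.P K) (i + 1)), ν (i + 1) y = ν i (emb y) * vframeU (dbarIterU i (gaugeActT g (unitsField (toUField U)))) y) ∧
                gs' 0 = g ∧ (∀ (i : ℕ) (y : Site (F.P K) (i + 1)), gs' (i + 1) y = gs' i (emb y)) ∧
                (∀ s, (Unitary.toUnits (suIncl (w (lift (F.P K) x₀ + rel x₀ s))))⁻¹ =
                  ((gs' (K - n) (iterBlockOf (K - n) x₀))⁻¹ * ν (K - n) (iterBlockOf (K - n) x₀)) * h' s * g s) ∧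
                (∀ yc ∈ cubeLamS (F.P K).L (fun μ => ((iterBlockOf (K - n) x₀ μ).val : ℤ) - t) M' (ρ + M + L + S) (K - n) (K - n) (K - n),
                  κ' (K - n) (coverAt (F.P K) (K - n) yc) =
                    axialT (dbarIterU (K - n) (gaugeActT g (unitsField (toUField U)))) (iterBlockOf (K - n) x₀) (coverAt (F.P K) (K - n) yc)) ∧
                -- [sizes] the two (1.36)♭ rows of `A := X ∘ rep`
                (∀ wt : ℕ → PBond (F.P K) 0 → ℝ, IsLevWeight F n K (cubeSeqMT3 F n K x₀ ρ S M hM) wt →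
                  (∀ b : PBond (F.P K) 0, wt 1 b *
                    ‖(fun b : PBond (F.P K) 0 => if b.src ∈ cubeSetM x₀ (K - n) ρ S M 0 ∧ b.tgt ∈ cubeSetM x₀ (K - n) ρ S M 0 then
                      X (lift (F.P K) x₀ + rel x₀ b.src) b.dir else 0) b‖ ≤ B₁ * ((ρ : ℝ) + 1) ^ qρ * ε₀) ∧
                  (∀ (b : PBond (F.P K) 0) (ν' : Fin (F.P K).d), wt 2 b * (F.L : ℝ) ^ (K - n) *
                    ‖(fun b : PBond (F.P K) 0 => if b.src ∈ cubeSetM x₀ (K - n) ρ S M 0 ∧ b.tgt ∈ cubeSetM x₀ (K - n) ρ S M 0 then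
                        X (lift (F.P K) x₀ + rel x₀ b.src) b.dir else 0) ⟨b.src.shift ν', b.dir⟩ -
                      (fun b : PBond (F.P K) 0 => if b.src ∈ cubeSetM x₀ (K - n) ρ S M 0 ∧ b.tgt ∈ cubeSetM x₀ (K - n) ρ S M 0 then
                        X (lift (F.P K) x₀ + rel x₀ b.src) b.dir else 0) b‖ ≤ B₁ * ((ρ : ℝ) + 1) ^ qρ * ε₀))) :
    ∀ L : ℕ, Odd L → 1 < L → ∃ (Mₚ Rₚ : ℕ), ∀ (R M aₑ S : ℕ) (hM : 1 ≤ M), M = L ^ aₑ → Mₚ ≤ M → Rₚ ≤ R → R * M ≤ S →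
      ∃ B₁ : ℝ, 0 ≤ B₁ ∧ ∃ Nr : ℕ, ∃ Cρ : ℝ, 0 < Cρ ∧ ∃ qρ : ℕ,
      ∀ (ρ : ℕ) (a Cr : ℝ), 0 < Cr → 4 < Cr → 12 * ((ρ : ℝ) + (M : ℝ)) * a ≤ Cr →
        16 * 3800 * ((5 * L : ℕ) : ℝ) ^ 2 * (L : ℝ) * ((B₁ * ((ρ : ℝ) + 1) ^ qρ + 1) * a) ≤ 1 → Cρ * ((ρ : ℝ) + 1) ^ qρ * a ≤ 1 →
        ∀ F : T3Family, F.L = L → ∀ (n K : ℕ) (hnK : n < K), 2 * ρ + Nr ≤ F.L ^ (F.m + n) →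
          ∀ (ε₀ ε₁ : ℝ), 0 < ε₁ → 0 < ε₀ → ε₀ ≤ a → Cr * ε₁ ≤ ε₀ →
          ∀ V : GaugeField (F.P n) 0 (Matrix.specialUnitaryGroup (Fin 2) ℂ), PlaqSmall ε₁ V →
            ∀ U ∈ regFibrePr F n K hnK.le ε₀ V, ∀ x : Site (F.P K) 0,
              P1FlatPillarAt' F n K (cubeSeqMT3 F n K x ρ S M hM) (cubeSetM x (K - n) ρ S M 0) x ε₀ ε₁ (B₁ * ((ρ : ℝ) + 1) ^ qρ) 6
                (8 * (L : ℝ) * (B₁ * ((ρ : ℝ) + 1) ^ qρ + 1)) U := by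
  intro L hodd hL
  obtain ⟨Mₚ, Rₚ, h⟩ := hSupUρ4 L hodd hL
  refine ⟨Mₚ, max Rₚ (2 * L), fun R M aₑ S hM hMe hMₚ hRₚ hRS => ?_⟩
  have hR : Rₚ ≤ R := le_trans (le_max_left _ _) hRₚ
  have h2L : 2 * L ≤ R := le_trans (le_max_right _ _) hRₚ
  obtain ⟨B₁, hB₁, M', _hM', Cρ, hCρ, qρ, hbody⟩ := h R M aₑ S hM hMe hMₚ hR hRS
  obtain ⟨hRM, hS⟩ := cubeData_of_prefix hL hM h2L hRS
  refine ⟨max B₁ 6, hB₁.trans (le_max_left _ _), M' + 1 + 2 * (M + L + S), Cρ, hCρ, qρ, fun ρ a Cr hCr hCr4 hreg₁ hreg₀ hregρ => ?_⟩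
  have hρ1 : (1 : ℝ) ≤ ((ρ : ℝ) + 1) ^ qρ := one_le_pow₀ (by linarith only [(Nat.cast_nonneg ρ : (0 : ℝ) ≤ ρ)])
  have hρ0 : (0 : ℝ) ≤ ((ρ : ℝ) + 1) ^ qρ := by positivity
  have h6 : (6 : ℝ) ≤ max B₁ 6 * ((ρ : ℝ) + 1) ^ qρ :=
    (le_max_right B₁ 6).trans (le_mul_of_one_le_right (le_trans (by norm_num) (le_max_right B₁ 6)) hρ1)
  have hB₁ρ : 0 ≤ B₁ * ((ρ : ℝ) + 1) ^ qρ := mul_nonneg hB₁ hρ0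
  have hB₁' : 0 ≤ max B₁ 6 * ((ρ : ℝ) + 1) ^ qρ + 1 := by linarith only [h6]
  have ha7 : 10 ^ 7 * (L : ℝ) ^ 3 * a ≤ 1 := ha7_of_window h6 hreg₀
  have hmono : B₁ * ((ρ : ℝ) + 1) ^ qρ ≤ max B₁ 6 * ((ρ : ℝ) + 1) ^ qρ := mul_le_mul_of_nonneg_right (le_max_left _ _) hρ0
  have hreg₀' : 16 * 3800 * ((5 * L : ℕ) : ℝ) ^ 2 * (L : ℝ) * ((B₁ * ((ρ : ℝ) + 1) ^ qρ + 1) * a) ≤ 1 := window_mono_B₁ hB₁ρ hmono hreg₀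
  have hNr : M ≤ M' + 1 + 2 * (M + L + S) := by omega
  have hρ' : 2 ≤ ρ + M + L + S := by omega
  have h0 : ρ + M ≤ ρ + M + L + S + 1 := by omega
  have h1 : L + S + M ≤ ρ + M + L + S + 2 := by omega
  have hNrW : M' + 1 + 2 * (ρ + M + L + S) ≤ 2 * ρ + (M' + 1 + 2 * (M + L + S)) := by omega
  refine p1FlatPillar'_room_of_suppliers L ρ S M (M' + 1 + 2 * (M + L + S)) hM hRS hRM hS hNr hCr hreg₁ hreg₀ hB₁' ha7
    M' (ρ + M + L + S) hρ' h0 h1 hNrW fun F hF n K hnK hroom ε₀ ε₁ hε₁ hε₀ hε₀a hCrε V hV U hU x₀ => ?_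
  obtain ⟨t, ht0, ht, w, X, μ, g, h', κ', ν, gs', hWnear, hX, hLan, h0', hs', hν0, hνs, hg0, hgs, hug, htop, hsize⟩ :=
    hbody ρ a Cr hCr hCr4 hreg₁ hreg₀' hregρ F hF n K hnK hroom ε₀ ε₁ hε₁ hε₀ hε₀a hCrε V hV U hU x₀
  refine ⟨t, ht0, ht, w, X, μ, g, h', κ', ν, gs', hWnear, hX, hLan, h0', hs', hν0, hνs, hg0, hgs, hug, htop, fun wt hwt => ⟨fun b => ?_, fun b ν' => ?_⟩⟩
  · exact ((hsize wt hwt).1 b).trans (mul_le_mul_of_nonneg_right hmono hε₀.le)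
  · exact ((hsize wt hwt).2 b ν').trans (mul_le_mul_of_nonneg_right hmono hε₀.le)

end Summit.QuantumFields.YangMills.Theorems.HalvingP1FlatPillarRoomOfSuppliersRho4

end
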